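import Literature.NumberTheory.LFunctions.Zhang2022.DetectorRecipeCertificateSchur
import Literature.NumberTheory.LFunctions.Zhang2022.RepairDetShiftPSDCert

/-!
# Zhang (2022) §18-margin repair rung, barrier extension (cell landau-siegel §E, slice S-E-p6-2):
# the E-010 slot DISCHARGED at a second detector — `Det.FormDetPSD (Det.shiftRecipe (1/2; 2, 5/2))` is a theorem

Y. Zhang, *Discrete mean estimates and the Landau–Siegel zero*, arXiv:2211.02515v1 [Zhang2022LandauSiegel] —
an unrefereed manuscript under adjudication. **WHAT THIS IS NOT: a claim about its Theorems 1–2, about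
Landau–Siegel zeros, about Parity, or about a repaired `Margin232`. The programme SEARCHES and TYPES; no claim
about Landau–Siegel zeros, Theorems 1–2 of arXiv:2211.02515 or a repaired Margin232 until a kernel theorem says so.**

`RepairDetShift` decides the shift-detector family `Repair.familyDetShift` with the slot
`Det.FormDetPSD (Det.shiftRecipe b)` DISPLAYED; at the printed `b = (1,2,3)` the slot is the tree theorem
`Det.formDetPSD_zhang`. Here the slot is PROVED at the sign-admissible, off-printed triple `b⋆ = (1/2; 2, 5/2)`
(`Det.SignAdmissible`, gap `k = 2`, first shift mid-gap): **`Det.formDetPSD_shiftRecipe_bStar`**, so the family's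
verdict is UNCONDITIONAL there (`Repair.detShift_verdict_bStar`). Method = the certificate format of
`DetectorRecipeCertificate` (`Det.formDetPSD_of_certificate`): an explicit Hermitian `2 × 2` matrix polynomial
`K(t)`, `t = 7πy/22 ∈ [0, 7π/22] ⊂ [0,1]`, of degree `8` with dyadic rational coefficients (a sub-solution of the
Riccati equation of the second-variation problem, FOUND numerically — kit job j260562 of the cell, script
`cert_search2.py` — and used here only as data: every inequality below is checked by the kernel), for which the
pointwise form `certForm` is non-negative by the Schur step `Det.hermForm3_nonneg_of_schur` (pivot
`16/(3π) > 0`; the two scalar conditions `s₁₁ > 0`, `det ≥ 0` are the polynomial inequalities `S11e ≥ 31/128` and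
`DETe ≥ 0` on `[0,1]`, proved by exact Bernstein expansions with non-negative coefficients, `S11e_ge`, `DETe_nonneg`)
and the boundary form `bdForm` is a positive definite Hermitian `2 × 2` form (`hermForm2_nonneg`). The recipe data
at `b⋆` are exact: `W(b⋆) = (1/6, −8i/3, 5/2)` (`shiftW_bStar`), moments
`(m₀, m_s, m_n, m_b, m_bs, m_bn) = (8/3 − 8i/3, 7 − 8i, 10/3 − 10i/3, 19/3 − 16i/3, 16 − 16i, 20/3 − 20i/3)`.

Currency (C3(e)): FormDet = formula I on ONE-SIDED kinked profiles (the slot's class); that the detector-`b⋆`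
constants ARE this form is E-det-main (open off `(1,2,3)`); nothing here is a statement about zeros.

References: Y. Zhang, arXiv:2211.02515v1 (2022), §2 (2.13), Lemma 2.3, (2.16); §7 Prop. 7.1 [p. 44]; §8 (8.11)–(8.23).
[cite: Zhang2022LandauSiegel, §2 Lemma 2.3; §7 Prop. 7.1; §8 (8.11)–(8.23)]
-/

noncomputable section

open Complex Real ComplexConjugate Set

namespace Literature.NumberTheory.LFunctions.Zhang2022

namespace Det

open Repair BStarCert

/-! ### `certForm` in the shape of `hermForm3_nonneg_of_schur` -/

/-- **`certForm` IS a `3 × 3` Hermitian form of the shape of `hermForm3_nonneg_of_schur`**, with pivot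
`r = (2/π)Re m₀`, couplings `p₁ = conj k₁₂`, `p₂ = k₂₂ + i(conj m_s + m_b)` and block `q₁₁ = k₁₁′`,
`q₁₂ = iπ²m_bn + k₁₂′ − k₁₁`, `q₂₂ = 2πRe(m_n + m_bs) + k₂₂′ − 2Re k₁₂` (so an instance proves `certForm ≥ 0`
from `s₁₁ > 0`, `det ≥ 0` of the Schur data). [cite: Zhang2022LandauSiegel, Prop 7.1 with (8.11)–(8.23), pp.44–50] -/
theorem certForm_eq_hermForm3 (R : DetRecipe) (k11 k11' k22 k22' : ℝ) (k12 k12' w v u : ℂ) :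
    certForm R k11 k11' k22 k22' k12 k12' w v u
      = 2 / π * (∑ j : Fin 3, R.W j).re * ‖u‖ ^ 2
        + 2 * (conj u * (conj k12 * w + ((k22 : ℂ) + I * (conj (∑ j : Fin 3, R.W j * (R.s j : ℂ))
            + ∑ j : Fin 3, R.W j * (R.b j : ℂ))) * v)).re
        + k11' * ‖w‖ ^ 2
        + 2 * (((I * π ^ 2 * (∑ j : Fin 3, R.W j * ((R.b j : ℂ) * (R.n j : ℂ))) + k12' - k11))
            * (conj w * v)).re
        + (2 * π * ((∑ j : Fin 3, R.W j * (R.n j : ℂ)) + ∑ j : Fin 3, R.W j * ((R.b j : ℂ) * (R.s j : ℂ))).re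
            + k22' - 2 * k12.re) * ‖v‖ ^ 2 := by
  simp only [certForm, pwForm, Complex.sq_norm, Complex.normSq_apply, Complex.add_re, Complex.add_im,
    Complex.sub_re, Complex.sub_im, Complex.mul_re, Complex.mul_im, Complex.conj_re, Complex.conj_im,
    Complex.ofReal_re, Complex.ofReal_im, Complex.I_re, Complex.I_im]
  simp only [← Complex.ofReal_pow, Complex.ofReal_re, Complex.ofReal_im]
  ring


/-! ### The three Schur identities at a point (complex-norm bookkeeping) -/

/-- `Re(8/3 − 8i/3) = 8/3`. [folklore] -/
private theorem re_m0 : ((8 / 3 - 8 / 3 * I : ℂ)).re = 8 / 3 := by norm_num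

/-- `‖a + ib‖² = a² + b²` for real `a, b`. [folklore] -/
private theorem normSq_re_add_im (a b : ℝ) : ‖(a : ℂ) + I * b‖ ^ 2 = a ^ 2 + b ^ 2 := by
  rw [Complex.sq_norm, Complex.normSq_apply]; simp [sq]

/-- `Re(a + ib) = a`. [folklore] -/
private theorem re_re_add_im (a b : ℝ) : ((a : ℂ) + I * b).re = a := by simp

/-- `(A + iB) − (c + id)(e + if)/r` in components (`r` real). [folklore] -/
private theorem sub_mul_div_ofReal (A B c d e f r : ℝ) :
    ((A : ℂ) + I * B) - ((c : ℂ) + I * d) * ((e : ℂ) + I * f) / (r : ℂ)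
      = (((A - (c * e - d * f) / r : ℝ)) : ℂ) + I * (((B - (c * f + d * e) / r : ℝ)) : ℂ) := by
  apply Complex.ext <;>
    simp only [Complex.add_re, Complex.add_im, Complex.sub_re, Complex.sub_im, Complex.mul_re, Complex.mul_im,
      Complex.div_ofReal_re, Complex.div_ofReal_im, Complex.ofReal_re, Complex.ofReal_im, Complex.I_re,
      Complex.I_im] <;>
    ring

/-- `k₁₂(y)` in components. [folklore] -/
private theorem k12c_eq (y : ℝ) :
    k12c y = ((π * Pre (lam * y) : ℝ) : ℂ) + I * ((π * Pim (lam * y) : ℝ) : ℂ) := by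
  unfold k12c; push_cast; ring

/-- `k₁₂′(y)` in components. [folklore] -/
private theorem k12d_eq (y : ℝ) :
    k12d y = ((π * (lam * Pred (lam * y)) : ℝ) : ℂ) + I * ((π * (lam * Pimd (lam * y)) : ℝ) : ℂ) := by
  unfold k12d; push_cast; ring

/-- the coupling `p₂ = k₂₂ + i(conj m_s + m_b)` in components: `(k₂₂ − 8/3) + (40/3)i`. [folklore] -/
private theorem p2_eq (y : ℝ) :
    (k22c y : ℂ) + I * (conj (7 - 8 * I : ℂ) + (19 / 3 - 16 / 3 * I))
      = ((k22c y - 8 / 3 : ℝ) : ℂ) + I * ((40 / 3 : ℝ) : ℂ) := by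
  apply Complex.ext
  · simp; ring
  · simp; norm_num

/-- the block entry `q₁₂ = iπ²m_bn + k₁₂′ − k₁₁` in components. [folklore] -/
private theorem q12_eq (y : ℝ) :
    I * π ^ 2 * (20 / 3 - 20 / 3 * I : ℂ) + k12d y - (k11c y : ℂ)
      = ((π ^ 2 * (20 / 3) + π * (lam * Pred (lam * y)) - π ^ 2 * P11 (lam * y) : ℝ) : ℂ)
        + I * ((π ^ 2 * (20 / 3) + π * (lam * Pimd (lam * y)) : ℝ) : ℂ) := by
  rw [k12d_eq, show (π : ℂ) ^ 2 = ((π ^ 2 : ℝ) : ℂ) by push_cast; ring]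
  unfold k11c
  apply Complex.ext
  · simp only [Complex.add_re, Complex.sub_re, Complex.mul_re, Complex.mul_im, Complex.sub_im,
      Complex.ofReal_re, Complex.ofReal_im, Complex.I_re, Complex.I_im, Complex.re_ofNat, Complex.im_ofNat,
      Complex.div_ofNat_re, Complex.div_ofNat_im]
    ring
  · simp only [Complex.sub_re, Complex.mul_re, Complex.mul_im, Complex.add_im, Complex.sub_im,
      Complex.ofReal_re, Complex.ofReal_im, Complex.I_re, Complex.I_im, Complex.re_ofNat, Complex.im_ofNat,
      Complex.div_ofNat_re, Complex.div_ofNat_im]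
    ring

/-- `s₁₁ = π³·S11e`. [cite: Zhang2022LandauSiegel, Prop 7.1 p.44] -/
private theorem schur11 (y : ℝ) :
    k11d y - ‖conj (k12c y)‖ ^ 2 / (2 / π * ((8 / 3 - 8 / 3 * I : ℂ)).re) = π ^ 3 * S11e (lam * y) := by
  rw [re_m0, Complex.norm_conj, k12c_eq, normSq_re_add_im]
  have hπ : π ≠ 0 := Real.pi_ne_zero
  unfold k11d S11e lam
  field_simp
  ring

/-- `s₂₂ = π·S22e`. [cite: Zhang2022LandauSiegel, Prop 7.1 p.44] -/
private theorem schur22 (y : ℝ) :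
    2 * π * ((10 / 3 - 10 / 3 * I : ℂ) + (16 - 16 * I)).re + k22d y - 2 * (k12c y).re
        - ‖(k22c y : ℂ) + I * (conj (7 - 8 * I : ℂ) + (19 / 3 - 16 / 3 * I))‖ ^ 2
          / (2 / π * ((8 / 3 - 8 / 3 * I : ℂ)).re)
      = π * S22e (lam * y) := by
  have h1 : (((10 / 3 - 10 / 3 * I : ℂ) + (16 - 16 * I))).re = 58 / 3 := by simp; norm_num
  rw [re_m0, h1, p2_eq, normSq_re_add_im, k12c_eq, re_re_add_im]
  have hπ : π ≠ 0 := Real.pi_ne_zero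
  unfold k22d k22c S22e lam
  field_simp
  ring

/-- `|s₁₂|² = π⁴·(S12re² + S12im²)`. [cite: Zhang2022LandauSiegel, Prop 7.1 p.44] -/
private theorem schur12 (y : ℝ) :
    ‖(I * π ^ 2 * (20 / 3 - 20 / 3 * I : ℂ) + k12d y - (k11c y : ℂ))
        - conj (conj (k12c y)) * ((k22c y : ℂ) + I * (conj (7 - 8 * I : ℂ) + (19 / 3 - 16 / 3 * I)))
          / ((2 / π * ((8 / 3 - 8 / 3 * I : ℂ)).re : ℝ) : ℂ)‖ ^ 2
      = π ^ 4 * (S12re (lam * y) ^ 2 + S12im (lam * y) ^ 2) := by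
  rw [re_m0, Complex.conj_conj, q12_eq, k12c_eq, p2_eq, sub_mul_div_ofReal, normSq_re_add_im]
  have hπ : π ≠ 0 := Real.pi_ne_zero
  unfold k22c S12re S12im lam
  field_simp
  ring

/-! ### The boundary form: a positive definite Hermitian `2 × 2` form -/

/-- `h₁₁|a|² + 2Re(h₁₂ ā b) + h₂₂|b|² ≥ 0` when `h₁₁ > 0`, `h₁₁h₂₂ − |h₁₂|² ≥ 0`. [folklore] -/
private theorem hermForm2_nonneg {h11 h22 : ℝ} {h12 : ℂ} (hpos : 0 < h11) (hdet : 0 ≤ h11 * h22 - ‖h12‖ ^ 2)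
    (a b : ℂ) : 0 ≤ h11 * ‖a‖ ^ 2 + 2 * (h12 * (conj a * b)).re + h22 * ‖b‖ ^ 2 := by
  have sq : h11 * (h11 * ‖a‖ ^ 2 + 2 * (h12 * (conj a * b)).re + h22 * ‖b‖ ^ 2)
      = ‖(h11 : ℂ) * a + h12 * b‖ ^ 2 + (h11 * h22 - ‖h12‖ ^ 2) * ‖b‖ ^ 2 := by
    rw [Complex.sq_norm, Complex.sq_norm, Complex.sq_norm, Complex.sq_norm]
    simp only [Complex.normSq_apply, Complex.add_re, Complex.add_im, Complex.mul_re, Complex.mul_im,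
      Complex.conj_re, Complex.conj_im, Complex.ofReal_re, Complex.ofReal_im]
    ring
  have : 0 ≤ h11 * (h11 * ‖a‖ ^ 2 + 2 * (h12 * (conj a * b)).re + h22 * ‖b‖ ^ 2) := by rw [sq]; positivity
  exact (mul_nonneg_iff_of_pos_left hpos).mp this

/-! ### The theorem -/

/-- **The E-010 slot at `b⋆ = (1/2; 2, 5/2)` is a theorem: `𝔅_{b⋆} ≥ 0` on one-sided kinked profiles.**
Proof = `Det.formDetPSD_of_certificate` with the explicit polynomial certificate `(k₁₁, k₂₂, k₁₂)` above: the
pointwise form is the `3 × 3` Hermitian form of `certForm_eq_hermForm3` with pivot `16/(3π) > 0` and Schur data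
`s₁₁ = π³·S11e > 0`, `det = π⁴·DETe ≥ 0` (`schur11/22/12`, `S11e_ge`, `DETe_nonneg`), and the boundary form is
positive definite (`hermForm2_nonneg`). [cite: Zhang2022LandauSiegel, §7 Prop. 7.1 p.44; §2 (2.16), Lemma 2.3] -/
theorem formDetPSD_shiftRecipe_bStar : FormDetPSD (shiftRecipe bStar) := by
  obtain ⟨hm0, hms, hmn, hmb, hmbs, hmbn⟩ := moments_bStar
  refine formDetPSD_of_certificate k11c k22c k11d k22d k12c k12d hasDerivAt_k11c hasDerivAt_k22c
    hasDerivAt_k12c continuous_k11d continuous_k22d continuous_k12d ?_ ?_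
  · intro y hy w v u
    have ht0 : 0 ≤ lam * y := mul_nonneg lam_pos.le hy.1
    have ht1 : lam * y ≤ 1 :=
      (mul_le_mul_of_nonneg_left hy.2 lam_pos.le).trans (by rw [mul_one]; exact lam_le_one)
    rw [certForm_eq_hermForm3, hm0, hms, hmn, hmb, hmbs, hmbn]
    refine hermForm3_nonneg_of_schur (r := 2 / π * ((8 / 3 - 8 / 3 * I : ℂ)).re) (q11 := k11d y)
      (q22 := 2 * π * ((10 / 3 - 10 / 3 * I : ℂ) + (16 - 16 * I)).re + k22d y - 2 * (k12c y).re)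
      (p1 := conj (k12c y)) (p2 := (k22c y : ℂ) + I * (conj (7 - 8 * I : ℂ) + (19 / 3 - 16 / 3 * I)))
      (q12 := I * π ^ 2 * (20 / 3 - 20 / 3 * I : ℂ) + k12d y - (k11c y : ℂ)) ?_ ?_ ?_ w v u
    · rw [re_m0]; positivity
    · rw [schur11]; exact mul_pos (by positivity) (by linarith [S11e_ge ht0 ht1])
    · rw [schur11, schur22, schur12]
      have hD := DETe_nonneg ht0 ht1
      have e : π ^ 3 * S11e (lam * y) * (π * S22e (lam * y))
            - π ^ 4 * (S12re (lam * y) ^ 2 + S12im (lam * y) ^ 2)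
          = π ^ 4 * DETe (lam * y) := by unfold DETe; ring
      rw [e]; exact mul_nonneg (by positivity) hD
  · intro a b
    simp only [bdForm]
    rw [hmn, k11c_zero, k22c_zero, k12c_zero]
    have hpos : (0:ℝ) < π ^ 2 * (543 / 256) := by positivity
    have hdet : 0 ≤ π ^ 2 * (543 / 256) * (247 / 256)
        - ‖(π : ℂ) * ((-(263 / 384) : ℂ) + I * (167 / 384 : ℂ))‖ ^ 2 := by
      have : ‖(π : ℂ) * ((-(263 / 384) : ℂ) + I * (167 / 384 : ℂ))‖ ^ 2
          = π ^ 2 * ((263 / 384) ^ 2 + (167 / 384) ^ 2) := by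
        rw [Complex.sq_norm, Complex.normSq_apply]
        simp only [Complex.mul_re, Complex.mul_im, Complex.add_re, Complex.add_im, Complex.neg_re,
          Complex.neg_im, Complex.ofReal_re, Complex.ofReal_im, Complex.I_re, Complex.I_im, Complex.re_ofNat,
          Complex.im_ofNat, Complex.div_ofNat_re, Complex.div_ofNat_im]
        ring
      rw [this]; nlinarith [sq_nonneg π]
    have h2 := hermForm2_nonneg hpos hdet a b
    have e : π ^ 2 * (543 / 256) * ‖a‖ ^ 2
          + 2 * ((π : ℂ) * ((339 / 128 : ℂ) + I * (-(371 / 128) : ℂ)) * (conj a * b)).re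
          + 247 / 256 * ‖b‖ ^ 2 - 2 * π * ((10 / 3 - 10 / 3 * I : ℂ) * (b * conj a)).re
        = π ^ 2 * (543 / 256) * ‖a‖ ^ 2
          + 2 * ((π : ℂ) * ((-(263 / 384) : ℂ) + I * (167 / 384 : ℂ)) * (conj a * b)).re
          + 247 / 256 * ‖b‖ ^ 2 := by
      simp only [Complex.mul_re, Complex.mul_im, Complex.add_re, Complex.add_im, Complex.sub_re,
        Complex.sub_im, Complex.neg_re, Complex.neg_im, Complex.ofReal_re, Complex.ofReal_im, Complex.I_re,
        Complex.I_im, Complex.conj_re, Complex.conj_im, Complex.re_ofNat, Complex.im_ofNat,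
        Complex.div_ofNat_re, Complex.div_ofNat_im]
      ring
    rw [e]; exact h2

/-- The same statement with the triple displayed. [cite: Zhang2022LandauSiegel, §7 Prop. 7.1 p.44; §2 Lemma 2.3] -/
theorem formDetPSD_shiftRecipe_half_two_fiveHalves : FormDetPSD (shiftRecipe ![1 / 2, 2, 5 / 2]) :=
  formDetPSD_shiftRecipe_bStar

end Det

/-! ### Consequence for the §E family `familyDetShift`: the verdict is UNCONDITIONAL at `b⋆` -/

namespace Repair

open Det Det.BStarCert

/-- **At the detector `b⋆ = (1/2; 2, 5/2)` no pair of one-sided kinked legs closes the joint main-order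
criterion** — the displayed slot of `RepairDetShift` discharged: `¬ (𝔅_{b⋆}(u)·𝔅_{b⋆}(f) < ‖P_{b⋆}(u,f)‖²)`.
[cite: Zhang2022LandauSiegel, §2 (2.18), Props. 2.4–2.6, (2.32)–(2.33)] -/
theorem detShift_verdict_bStar {u u' f f' : ℝ → ℂ} (hu : KinkedProfile u u') (hf : KinkedProfile f f')
    (hu1 : u 1 = 0) (hf1 : f 1 = 0) :
    ¬ (FormDet (shiftRecipe bStar) u u' * FormDet (shiftRecipe bStar) f f'
        < ‖FormDetPolar (shiftRecipe bStar) u u' f f'‖ ^ 2) :=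
  not_trueNeed_of_psd formDetPSD_shiftRecipe_bStar hu hf hu1 hf1

/-- Every member of `familyDetShift` with `b = b⋆` satisfies the verdict's conclusion outright.
[cite: Zhang2022LandauSiegel, §2 (2.18), (2.32)–(2.33)] -/
theorem detShift_unconditional_bStar (d : DetShiftDesign) (h : d.InClass) (hb : d.b = bStar) :
    ¬ (FormDet (shiftRecipe d.b) d.u d.u' * FormDet (shiftRecipe d.b) d.f d.f'
        < ‖FormDetPolar (shiftRecipe d.b) d.u d.u' d.f d.f'‖ ^ 2) :=
  not_repairable_detShift d h (hb ▸ formDetPSD_shiftRecipe_bStar)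

/-- Non-vacuity: the `𝔡`- and `𝔡′`-block legs of the printed design `θ₀` under the detector `b⋆` are members.
[cite: Zhang2022LandauSiegel, §2 (2.13), (2.21)–(2.28)] -/
theorem inClass_legs_theta0_bStar : (dLeg bStar theta0).InClass ∧ (dPrimeLeg bStar theta0).InClass :=
  ⟨inClass_dLeg signAdmissible_bStar admissible_theta0.toCalc,
    inClass_dPrimeLeg signAdmissible_bStar admissible_theta0.toCalc⟩

end Repair

end Literature.NumberTheory.LFunctions.Zhang2022
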